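import Summits.Ventures.YMGap.RobustBall.StringTensionExplicit
import Summits.Ventures.YMGap.RobustBall.TorusRowsSU3StarCertified
import HarnessLib

/-!
# Robust ball (Y2), area-law side — explicit `SU(3)` string-tension floors (GIVEN the cell's certificates H1, H2) and
the `SU(2)`, `d = 3` ball cell

HONEST FRAMING: venture file of the cell `pub-ymgap` (QuantumFields programme), track ROBUST-BALL, seat rb-p2 (g4).  LATTICE statements
about infinite-volume limit states of the torus Wilson states (`infiniteVolumeLimitPoints`) of `SU(3)` lattice Yang–Mills, `d = 4`, tree
coupling `β_W/3` ('t Hooft `β_W/9`).  The `SU(3)` column of the cell is CONDITIONAL on two one-link certificates displayed as hypotheses —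
H1 `OneLinkPoincareSUN 3 (3/5) (4/5)` and H2 `OneLinkVarianceBound 3 (11/30) (49/20)` (engine-2's two-lineage numerics; NOT tree theorems) —
which give the modulus `OneLinkKRModulus 3 (11/30) (7/5)` (`su3_certifiedModulus_of_pair`), hence the slab Dobrushin constant
`c_W = 2·3·(β_W/9)·(7/5) = 14β_W/15` on `0 < β_W ≤ 11/20`.  Run through `StringTensionExplicit.wilson_stringTension_ge_explicit`:
GIVEN H1, H2, every infinite-volume limit state has string tension `σ(μ) ≥ log(15/(14β_W))` (`β_W = 1/8`: `≥ 2.14`; `11/20`: `≥ 0.66`).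
The hypothesis-free `SU(3)` floor is the every-`N` Bakry–Émery one (`StringTensionExplicit.suN_stringTension_ge_log`).  Floors are door
artefacts; nothing continuum / spectral / Clay.

References: E. Seiler, LNP 159 (1982) §2; Cao–Nissim–Sheffield arXiv:2509.04688v2 Thm 2.3.
-/

noncomputable section

open MeasureTheory Filter Topology
open Literature.MathematicalPhysics.QuantumLattice
open Literature.MathematicalPhysics.QuantumFieldTheory hiding ZdEdge Site
open Literature.MathematicalPhysics.QuantumFieldTheory.Balaban1983to89.StrongCouplingDobrushinWindow (OneLinkKRModulus)
open Summit.QuantumFields.BalabanUV.InfraRed.StrongCouplingPoincareDoorSUN (OneLinkPoincareSUN)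
open Summit.QuantumFields.BalabanUV.InfraRed.StrongCouplingVarianceDoorSUN (OneLinkVarianceBound)

namespace Summit.Ventures.YMGap.RobustBall

namespace StringTensionExplicit

/-- ★ **`SU(3)`, `d = 4`, GIVEN H1, H2: `σ(μ) ≥ log(15/(14β_W))` for every infinite-volume limit state at every `0 < β_W ≤ 11/20`**
(tree coupling `β_W/3`; the certified modulus `K = 7/5` on the slab ball `2β_W/3 ≤ 11/30`, slab Dobrushin constant `14β_W/15`).
[folklore] -/
theorem su3_stringTension_ge_log_dim4_of_H1H2 (hP : OneLinkPoincareSUN 3 (3 / 5) (4 / 5))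
    (hV : OneLinkVarianceBound 3 (11 / 30) (49 / 20)) {βW : ℝ} (hβ : 0 < βW) (hβ1 : βW ≤ 11 / 20)
    {μ : Measure (LGConfig 4 (SUN 3))} (hμ : μ ∈ infiniteVolumeLimitPoints (fundamentalRep (Fin 3)) (βW / 3)) :
    HasStringTension μ (fun g => normalisedCharacter 3 (fundamentalRep (Fin 3) g))
        (stringTension μ (fun g => normalisedCharacter 3 (fundamentalRep (Fin 3) g))) ∧
      Real.log (15 / (14 * βW)) ≤ stringTension μ (fun g => normalisedCharacter 3 (fundamentalRep (Fin 3) g)) := by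
  have hmod : OneLinkKRModulus 3 (11 / 30) (7 / 5) := su3_certifiedModulus_of_pair hP hV
  have habs : |βW / 3 / ((3 : ℕ) : ℝ)| = βW / 9 := by rw [abs_of_nonneg (by positivity)]; push_cast; ring
  have hcW : 2 * ((3 : ℕ) : ℝ) * |βW / 3 / ((3 : ℕ) : ℝ)| * (7 / 5) = 14 * βW / 15 := by rw [habs]; push_cast; ring
  have hθ0 : 0 < 14 * βW / 15 := by positivity
  have hθ1 : 14 * βW / 15 ≤ 1 := by linarith
  obtain ⟨hσ, h⟩ := wilson_stringTension_ge_explicit (n := 3) (N := 3) (by norm_num) (by norm_num) (by positivity)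
    (by norm_num) hmod (by rw [habs]; push_cast; linarith) (by rw [hcW]; exact hθ1) hθ0 hθ1 hμ
  refine ⟨hσ, ?_⟩
  rw [hcW, max_self] at h
  have hlog : Real.log (15 / (14 * βW)) = -Real.log (14 * βW / 15) := by
    rw [← Real.log_inv]; congr 1; field_simp
  rw [hlog]; exact h

/-- ★ **`SU(3)`, `d = 4`, HYPOTHESIS-FREE (Bakry–Émery modulus): `σ(μ) ≥ log((3 − 4β_W)/(4β_W))` for every infinite-volume limit
state at every `0 < β_W ≤ 3/8`** (slab radius `R_s = 6·β_W/9 = 2β_W/3 ≤ 1/4`; `β_W = 1/8`: `≥ log 5 ≥ 1.60`; `3/8`: `≥ 0`).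
[cite: arXiv220412737, Lemma 4.1] -/
theorem su3_stringTension_ge_log_dim4 {βW : ℝ} (hβ : 0 < βW) (hβ1 : βW ≤ 3 / 8)
    {μ : Measure (LGConfig 4 (SUN 3))} (hμ : μ ∈ infiniteVolumeLimitPoints (fundamentalRep (Fin 3)) (βW / 3)) :
    HasStringTension μ (fun g => normalisedCharacter 3 (fundamentalRep (Fin 3) g))
        (stringTension μ (fun g => normalisedCharacter 3 (fundamentalRep (Fin 3) g))) ∧
      Real.log ((3 - 4 * βW) / (4 * βW)) ≤ stringTension μ (fun g => normalisedCharacter 3 (fundamentalRep (Fin 3) g)) := by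
  have habs : |βW / 3 / ((3 : ℕ) : ℝ)| * (2 * ((3 : ℕ) : ℝ)) = 2 * βW / 3 := by
    rw [abs_of_nonneg (by positivity)]; push_cast; ring
  obtain ⟨hσ, h⟩ := suN_stringTension_ge_log (n := 3) (N := 3) (by norm_num) (by norm_num) (β := βW / 3) (by positivity)
    (by rw [habs]; linarith) hμ
  refine ⟨hσ, ?_⟩
  rw [habs] at h
  have e : (1 / 2 - 2 * βW / 3) / (2 * βW / 3) = (3 - 4 * βW) / (4 * βW) := by
    field_simp; ring
  rw [e] at h
  exact h

end StringTensionExplicit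

end Summit.Ventures.YMGap.RobustBall
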